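import Literature.MathematicalPhysics.QuantumFieldTheory.Balaban1983to89.B9Eq365QGGQLowerVariationalWindowTowerSharp
import Literature.MathematicalPhysics.QuantumFieldTheory.Balaban1983to89.B9Eq365QGGQLowerVariationalSharpFloor

/-!
# `Balaban1983to89.B9Eq365QGGQLowerVariationalWindowTowerSharpDiagonal` — T. Bałaban, *Propagators for lattice gauge theories in a background field*,
# Commun. Math. Phys. **99** (1985) 389–434 [Balaban1985BackgroundPropagators] Thm 3.11 p. 416 with (3.16)∕(3.19) p. 393, (3.24)–(3.25) p. 394,
# (3.35)–(3.37) p. 396, and [Balaban1984PropagatorsI] (1.18) p. 20: **ON PRINT's DIAGONAL UNDER THE GEOMETRIC PROFILE THE `k`-LEVEL THIRD OPERATOR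
# `Q̃′_kG′_k(U)²Q̃′_k(U)†` IS BOUNDED BELOW BY `κ♯₀(d, a′) = 1∕(36(24d(6∕5)^{d−1} + 1 + 9a′∕4)²)` — `9.7·10⁻⁷` AT `d = 4`, `a′ = 1`, THE SAME AT EVERY
# HEIGHT, BLOCK RATIO, RATE, PERIOD AND WEIGHTS** — the diagonal reading of this seat's pedestal closed form (`…WindowTowerSharp`) through the pure-real
# floor (`…SharpFloor`): KAPPA1's `k`-level number moves from the tent's `5.8·10⁻²⁰` to `9.7·10⁻⁷` (the flat pedestal value is `1.4·10⁻⁴`)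

statement-level skeleton of published theorems with citation tags; proofs where landed; nothing here is a claim about the Yang–Mills mass gap

CITATION HEADER (lean-in-tree rule).  Audit cell `pub-balaban`, sub-cell `t4`, BINDER row NE9; filed by NE9 crux-team LEAF PROVER 03
(`b2b-balaban-t4-ne9-formalise-leaf-03`, gen 73).  Composition BY NAME of the two prequels (same seat) with this lineage's g64 profile bound
`B9Thm311SitePrimeFormCoerciveTowerCanonical.rhoTower_le_exp_sub_one`.  Sources READ: as the prequels.

WHAT IS PROVED (sorry-free; proof lane — 0 `def`; [folklore] threshold arithmetic).
* **`qggq_coercive_tower_sharp_diagonal_geometric`** — for a background `U` on `T_{L^{n+1}m}` with `U(b) ∈ U1`, `‖U(b) − 1‖ ≤ αη`, level averages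
  `‖Ū^j(b) − 1‖ ≤ ε_j ≤ αr^j` in `U1`, mutually adjoint transporters, the displayed positivity `hpos′`, on `ηL^{n+1} = 1`, `c₀(L^{n+1})^d = c₁`, with
  `0 ≤ α` and the two LEVEL-FREE windows `exp(d(L−1)Kα∕(1−r)) − 1 ≤ (10∕21)^d∕2`, `dK²α²(441∕100)^d ≤ 1∕2` (`K = 2M_φM_φ′`):
  `κ♯₀·‖ψ‖² ≤ re⟪ψ, Q̃′_kG′_k(U)²Q̃′_k(U)†ψ⟫`, `κ♯₀ = 1∕(36(24d(6∕5)^{d−1} + 1 + 9a′∕4)²)` — `B9Eq325ProjFormulaTower.QGGQk_pos`'s operator VERBATIM.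
* **`exists_qggq_coercive_tower_sharp_diagonal`** — `∃ κ > 0, ∀ L (every `L ≥ 1`), ∀ r ∈ [0,1[, ∃ α₁ > 0, ∀ n η c₀ c₁ m U α (ε_j) hpos′ ψ`:
  `κ‖ψ‖² ≤ re⟪ψ, Q̃′_kG′_k(U)²Q̃′_k(U)†ψ⟫` with `κ = κ♯₀` — the KAPPA1 shape at the pedestal size.
HONEST SCOPE.  Packaging; `κ♯₀` is the cell's variational floor (structural losses of the window road kept crude, a factor ≈ 150 below the flat
pedestal value), NOT print's constant; `hRS`, profile, `U1` DISPLAYED; `L²` floor only — NOT the kernel decay; NOT NE9 (cell pub-balaban: NE9 NOT PRINTED ∕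
NOT PROVED; «NE9 ⇐ the named binders»; row WALLED ON A MODEL (O-NE9-1; #5 UNRULED); spine PROVED 0∕9; rung (B)+1 on a finite T⁴ — NOT infinite volume, NOT
mass gap, NOT BetaPertH, NOT Clay; HONEST DEPENDENCY: continuum YM on T⁴ ⇐ BetaPertH ∧ nine spine estimates (0/9 proved); BetaPertH ⇐ (D1) ∧ (D4) ∧
CAP+tail; G-an2-4 gates asym, D1 and NE2/3/4).  NEW file importing the two prequels; nothing modified.  Net new unproved facts: 0.
-/

noncomputable section

open scoped InnerProductSpace ComplexConjugate BigOperators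

namespace Literature.MathematicalPhysics.QuantumFieldTheory.Balaban1983to89.B9Eq365QGGQLowerVariationalWindowTowerSharpDiagonal

open B4Sect5Torus (TSite)
open B9SectCLatticeCarrier (Bond)
open B7Prop1Explicit (U1)
open B9Eq311L2Pairing (WL2)
open B11Eq103H1Complex (SiteL2K)
open B9Eq310HessianOperator (adTransportW)
open B9Eq315QTower (towerP UlevOf)
open B9Eq326OperatorTower (QprimeTowerW)
open B9Eq324DeltaPrimeATower (laplacePrimeAk GpOfUk)
open B9Thm311SitePrimeFormCoerciveTowerCanonical (rhoTower_nonneg rhoTower_le_exp_sub_one)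
open B9Eq365QGGQLowerVariationalWindowTowerSharp (qggq_coercive_window_tower_sharp)
open B9Eq365QGGQLowerVariationalSharpFloor (kappa_sharp_floor window_of_ratio_sharp)

variable {d : ℕ} (L : ℕ) [NeZero L] (m : Fin d → ℕ) [∀ i, NeZero (m i)] (n : ℕ)
  {𝔸 : Type*} [NormedRing 𝔸] [NormedAlgebra ℂ 𝔸] [CompleteSpace 𝔸] [NormOneClass 𝔸]
  {W : Type*} [NormedAddCommGroup W] [InnerProductSpace ℂ W] [FiniteDimensional ℂ W] (φ : W ≃ₗ[ℂ] 𝔸)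
  (c₀ : ℝ) [Fact (0 < c₀)] (η : ℝ) (c₁ : ℝ) [Fact (0 < c₁)]

/-- **THE `k`-LEVEL THIRD OPERATOR ON PRINT's DIAGONAL UNDER THE GEOMETRIC PROFILE, PEDESTAL FLOOR — `κ♯₀(d, a′)` AT EVERY HEIGHT**: for
`ηL^{n+1} = 1`, `c₀(L^{n+1})^d = c₁`, fine bonds `‖U(b) − 1‖ ≤ αη` in `U1`, level averages `‖Ū^j(b) − 1‖ ≤ ε_j ≤ αr^j` in `U1`, mutually adjoint
transporters, the displayed positivity `hpos′`, `0 ≤ α` and the LEVEL-FREE windows `exp(d(L−1)Kα∕(1−r)) − 1 ≤ (10∕21)^d∕2`, `dK²α²(441∕100)^d ≤ 1∕2`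
(`K = 2M_φM_φ′`): `κ♯₀·‖ψ‖² ≤ re⟪ψ, Q̃′_kG′_k(U)²Q̃′_k(U)†ψ⟫`, `κ♯₀ = 1∕(36Λ♯²)`, `Λ♯ = 24d(6∕5)^{d−1} + 1 + 9a′∕4`.
[cite: Balaban1985BackgroundPropagators, Thm 3.11 p.416, (3.19) p.393, (3.24)–(3.25) p.394, (3.35)–(3.37) p.396; Balaban1984PropagatorsI, (1.18) p.20] -/
theorem qggq_coercive_tower_sharp_diagonal_geometric {a' : ℝ} (ha' : 0 < a') {Mφ Mφ' : ℝ} (hMφ : 0 ≤ Mφ) (hMφ' : 0 ≤ Mφ')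
    (hφ : ∀ w, ‖φ w‖ ≤ Mφ * ‖w‖) (hφ' : ∀ X, ‖φ.symm X‖ ≤ Mφ' * ‖X‖)
    (U : Bond d (towerP L m (n + 1)) → 𝔸ˣ) (hU : ∀ b, U b ∈ U1 𝔸) {α : ℝ} (hα0 : 0 ≤ α)
    (hUε : ∀ b, ‖(U b : 𝔸) - 1‖ ≤ α * η) (εU : ℕ → ℝ) (hεU : ∀ j, 0 ≤ εU j)
    (hLε : ∀ (j : ℕ) (b : Bond d (towerP L m (j + 1))), ‖(UlevOf L m (n + 1) U j b : 𝔸) - 1‖ ≤ εU j)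
    (hLb : ∀ (j : ℕ) (b : Bond d (towerP L m (j + 1))), UlevOf L m (n + 1) U j b ∈ U1 𝔸)
    (hRS : ∀ (b : Bond d (towerP L m (n + 1))) (v u : W), ⟪adTransportW φ U b v, u⟫_ℂ = ⟪v, adTransportW φ (fun b => (U b)⁻¹) b u⟫_ℂ)
    (hpos' : ∀ x : SiteL2K ℂ d (towerP L m (n + 1)) c₀ W, x ≠ 0 → 0 < RCLike.re ⟪x, laplacePrimeAk L m n φ η U a' (c₁ := c₁) x⟫_ℂ)
    (hηL : η * (L : ℝ) ^ (n + 1) = 1) (hw : c₀ * ((L : ℝ) ^ (n + 1)) ^ d = c₁)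
    {r : ℝ} (hr0 : 0 ≤ r) (hr1 : r < 1) (hεg : ∀ j < n + 1, εU j ≤ α * r ^ j)
    (hwin : Real.exp (((d * (L - 1) : ℕ) : ℝ) * (2 * Mφ * Mφ' * α / (1 - r))) - 1 ≤ (10 / 21 : ℝ) ^ d / 2)
    (hKα : (d : ℝ) * (2 * Mφ * Mφ') ^ 2 * α ^ 2 * (441 / 100) ^ d ≤ 1 / 2)
    (ψ : SiteL2K ℂ d m c₁ W) :
    1 / (36 * (24 * (d : ℝ) * (6 / 5) ^ (d - 1) + 1 + 9 * a' / 4) ^ 2) * ‖ψ‖ ^ 2 ≤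
      RCLike.re ⟪ψ, (((WL2.linearEquiv ℂ ℂ (fun _ : TSite d m => c₁)).symm.toLinearMap ∘ₗ QprimeTowerW L m n φ U (c₀ := c₀)) ∘ₗ
        GpOfUk L m n φ η U a' (c₁ := c₁) hpos' ∘ₗ GpOfUk L m n φ η U a' (c₁ := c₁) hpos' ∘ₗ
        LinearMap.adjoint ((WL2.linearEquiv ℂ ℂ (fun _ : TSite d m => c₁)).symm.toLinearMap ∘ₗ QprimeTowerW L m n φ U (c₀ := c₀))) ψ⟫_ℂ := by
  have hc₀ : 0 < c₀ := Fact.out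
  have hc₁ : 0 < c₁ := Fact.out
  have hL0 : (0 : ℝ) < L := by exact_mod_cast Nat.pos_of_ne_zero (NeZero.ne L)
  have hL1 : (1 : ℝ) ≤ L := by exact_mod_cast Nat.pos_of_ne_zero (NeZero.ne L)
  have hN1 : (1 : ℝ) ≤ (L : ℝ) ^ (n + 1) := one_le_pow₀ hL1
  have hN0 : (0 : ℝ) < (L : ℝ) ^ (n + 1) := by linarith
  have hη0 : 0 < η := pos_of_mul_pos_left (by rw [hηL]; exact one_pos) hN0.le
  have hK0 : 0 ≤ 2 * Mφ * Mφ' := by positivity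
  set ρ' : ℝ := (∏ j ∈ Finset.range (n + 1), (1 + 2 * Mφ * Mφ' * εU j) ^ (d * (L - 1))) - 1 with hρ'
  have hρ0 : 0 ≤ ρ' := rhoTower_nonneg n hK0 εU hεU (d * (L - 1))
  have hρle : ρ' ≤ (10 / 21 : ℝ) ^ d / 2 := (rhoTower_le_exp_sub_one n hK0 hr0 hr1 hα0 εU hεU hεg (d * (L - 1))).trans hwin
  have hwin' : ρ' * ((L : ℝ) ^ (n + 1) / 2 + ((L : ℝ) ^ (n + 1)) ^ 2 / 4) ^ d ≤ 1 / 2 * ((((L : ℝ) ^ (n + 1)) ^ 2 + 2) / 6) ^ d := by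
    have h := window_of_ratio_sharp hN0.le d hρle
    linarith
  have key := qggq_coercive_window_tower_sharp L m n φ c₀ η c₁ ha' hMφ hMφ' hφ hφ' U hU (ε := α * η) (by positivity) hUε εU hεU hLε hLb
    hRS hpos' (θ := 1 / 2) (t := 1) (by norm_num) one_pos hwin' ψ
  -- the diagonal readings `|η⁻¹| = L^{n+1}`, `c₀L^{(n+1)d}∕c₁ = 1`, `c₀∕c₁ = L^{−(n+1)d}`, `|η⁻¹|·Kαη = Kα`
  have hηinv : ‖((η : ℂ))⁻¹‖ = (L : ℝ) ^ (n + 1) := by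
    rw [norm_inv, Complex.norm_real, Real.norm_eq_abs, abs_of_pos hη0,
      show η = ((L : ℝ) ^ (n + 1))⁻¹ by rw [← one_div]; field_simp; linarith [hηL], inv_inv]
  have hρw1 : c₀ * ((L : ℝ) ^ (n + 1)) ^ d / c₁ = 1 := by rw [hw, div_self hc₁.ne']
  have hv : c₀ / c₁ = (((L : ℝ) ^ (n + 1)) ^ d)⁻¹ := by rw [← hw]; field_simp
  have he : ‖((η : ℂ))⁻¹‖ * (2 * Mφ * Mφ' * (α * η)) ≤ 2 * Mφ * Mφ' * α := by
    rw [hηinv, show (L : ℝ) ^ (n + 1) * (2 * Mφ * Mφ' * (α * η)) = 2 * Mφ * Mφ' * α * (η * (L : ℝ) ^ (n + 1)) by ring, hηL,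
      mul_one]
  have hfloor := kappa_sharp_floor (d := d) hN1 ha' (by positivity : 0 ≤ 2 * Mφ * Mφ' * (α * η)) hηinv hρw1 hv he hρ0 hwin' hKα
  exact le_trans (mul_le_mul_of_nonneg_right hfloor (sq_nonneg _)) key

/-! ## §2 `∃ κ > 0` before the block ratio, the rate and the height — the pedestal size -/

section Exists

/-- `exp y − 1 ≤ 2y` on `0 ≤ y ≤ 1` (private arithmetic helper). [folklore] -/
private theorem exp_sub_one_le_two_mul {y : ℝ} (hy0 : 0 ≤ y) (hy1 : y ≤ 1) : Real.exp y - 1 ≤ 2 * y := by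
  have h := Real.abs_exp_sub_one_sub_id_le (x := y) (by rw [abs_of_nonneg hy0]; exact hy1)
  have h' : Real.exp y - 1 - y ≤ y ^ 2 := (le_abs_self _).trans h
  nlinarith

variable {d : ℕ} {𝔸 : Type*} [NormedRing 𝔸] [NormedAlgebra ℂ 𝔸] [CompleteSpace 𝔸] [NormOneClass 𝔸]
  {W : Type*} [NormedAddCommGroup W] [InnerProductSpace ℂ W] [FiniteDimensional ℂ W] (φ : W ≃ₗ[ℂ] 𝔸)
  {a' Mφ Mφ' : ℝ} (ha' : 0 < a') (hMφ : 0 ≤ Mφ) (hMφ' : 0 ≤ Mφ') (hφ : ∀ w, ‖φ w‖ ≤ Mφ * ‖w‖) (hφ' : ∀ X, ‖φ.symm X‖ ≤ Mφ' * ‖X‖)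

include ha' hMφ hMφ' hφ hφ' in
/-- **KAPPA1, `k`-LEVEL HALF AT THE PEDESTAL SIZE — `∃ κ > 0` BEFORE THE BLOCK RATIO (every `L ≥ 1`), THE RATE, THE HEIGHT, THE LATTICE AND THE
BACKGROUND**: `κ = κ♯₀(d, a′) = 1∕(36(24d(6∕5)^{d−1} + 1 + 9a′∕4)²)`; for every `L` and `r ∈ [0,1[` the window `α₁ = min (min 1 ((10∕21)^d∕(4(c+1))))
(1∕(2(c′+1)·(21∕10)^d))`, `c = d(L−1)K∕(1−r)`, `c′ = dK`, `K = 2M_φM_φ′`.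
[cite: Balaban1985BackgroundPropagators, Thm 3.11 p.416, (3.19) p.393, (3.24)–(3.25) p.394, (3.35)–(3.37) p.396; Balaban1984PropagatorsI, (1.18) p.20] -/
theorem exists_qggq_coercive_tower_sharp_diagonal :
    ∃ κ : ℝ, 0 < κ ∧ ∀ (L : ℕ) [NeZero L] (r : ℝ), 0 ≤ r → r < 1 →
      ∃ α₁ : ℝ, 0 < α₁ ∧ ∀ (n : ℕ) (η : ℝ), η * (L : ℝ) ^ (n + 1) = 1 →
      ∀ (c₀ c₁ : ℝ) [Fact (0 < c₀)] [Fact (0 < c₁)], c₀ * ((L : ℝ) ^ (n + 1)) ^ d = c₁ →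
      ∀ (m : Fin d → ℕ) [∀ i, NeZero (m i)] (U : Bond d (towerP L m (n + 1)) → 𝔸ˣ),
        (∀ (b : Bond d (towerP L m (n + 1))) (v u : W), ⟪adTransportW φ U b v, u⟫_ℂ = ⟪v, adTransportW φ (fun b => (U b)⁻¹) b u⟫_ℂ) →
      ∀ (α : ℝ), 0 ≤ α → α ≤ α₁ → (∀ b, U b ∈ U1 𝔸) → (∀ b, ‖(U b : 𝔸) - 1‖ ≤ α * η) →
      ∀ (εU : ℕ → ℝ), (∀ j, 0 ≤ εU j) → (∀ j < n + 1, εU j ≤ α * r ^ j) →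
        (∀ (j : ℕ) (b : Bond d (towerP L m (j + 1))), ‖(UlevOf L m (n + 1) U j b : 𝔸) - 1‖ ≤ εU j) →
        (∀ (j : ℕ) (b : Bond d (towerP L m (j + 1))), UlevOf L m (n + 1) U j b ∈ U1 𝔸) →
      ∀ (hpos' : ∀ x : SiteL2K ℂ d (towerP L m (n + 1)) c₀ W, x ≠ 0 → 0 < RCLike.re ⟪x, laplacePrimeAk L m n φ η U a' (c₁ := c₁) x⟫_ℂ)
        (ψ : SiteL2K ℂ d m c₁ W),
        κ * ‖ψ‖ ^ 2 ≤
          RCLike.re ⟪ψ, (((WL2.linearEquiv ℂ ℂ (fun _ : TSite d m => c₁)).symm.toLinearMap ∘ₗ QprimeTowerW L m n φ U (c₀ := c₀)) ∘ₗ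
            GpOfUk L m n φ η U a' (c₁ := c₁) hpos' ∘ₗ GpOfUk L m n φ η U a' (c₁ := c₁) hpos' ∘ₗ
            LinearMap.adjoint ((WL2.linearEquiv ℂ ℂ (fun _ : TSite d m => c₁)).symm.toLinearMap ∘ₗ QprimeTowerW L m n φ U (c₀ := c₀))) ψ⟫_ℂ := by
  refine ⟨1 / (36 * (24 * (d : ℝ) * (6 / 5) ^ (d - 1) + 1 + 9 * a' / 4) ^ 2), by positivity, ?_⟩
  intro L _ r hr0 hr1
  have h1r : 0 < 1 - r := by linarith
  obtain ⟨c, hc0, hcdef⟩ : ∃ c : ℝ, 0 ≤ c ∧ c = ((d * (L - 1) : ℕ) : ℝ) * (2 * Mφ * Mφ') / (1 - r) := ⟨_, by positivity, rfl⟩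
  obtain ⟨c', hc0', hcdef'⟩ : ∃ c' : ℝ, 0 ≤ c' ∧ c' = (d : ℝ) * (2 * Mφ * Mφ') := ⟨_, by positivity, rfl⟩
  have hX1 : (10 / 21 : ℝ) ^ d ≤ 1 := pow_le_one₀ (by norm_num) (by norm_num)
  have hY1 : (1 : ℝ) ≤ (21 / 10 : ℝ) ^ d := one_le_pow₀ (by norm_num)
  refine ⟨min (min 1 ((10 / 21 : ℝ) ^ d / (4 * (c + 1)))) (1 / (2 * (c' + 1) * (21 / 10 : ℝ) ^ d)),
    lt_min (lt_min one_pos (by positivity)) (by positivity), ?_⟩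
  intro n η hηL c₀ c₁ _ _ hw m _ U hRS α hα0 hαle hUb hUε εU hεU hεg hLε hLb hpos' ψ
  have hαc : α * (4 * (c + 1)) ≤ (10 / 21 : ℝ) ^ d :=
    (le_div_iff₀ (by positivity)).1 (hαle.trans ((min_le_left _ _).trans (min_le_right _ _)))
  have hαK : α * (2 * (c' + 1) * (21 / 10 : ℝ) ^ d) ≤ 1 := (le_div_iff₀ (by positivity)).1 (hαle.trans (min_le_right _ _))
  have hy0 : 0 ≤ c * α := mul_nonneg hc0 hα0
  have hcα : c * α ≤ (c + 1) * α := mul_le_mul_of_nonneg_right (by linarith) hα0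
  have hy1 : c * α ≤ 1 := by linarith [hcα, hαc, hX1]
  have hwin : Real.exp (((d * (L - 1) : ℕ) : ℝ) * (2 * Mφ * Mφ' * α / (1 - r))) - 1 ≤ (10 / 21 : ℝ) ^ d / 2 := by
    rw [show ((d * (L - 1) : ℕ) : ℝ) * (2 * Mφ * Mφ' * α / (1 - r)) = c * α by rw [hcdef]; field_simp]
    calc Real.exp (c * α) - 1 ≤ 2 * (c * α) := exp_sub_one_le_two_mul hy0 hy1
      _ ≤ (10 / 21 : ℝ) ^ d / 2 := by linarith [hcα, hαc]
  have hKα : (d : ℝ) * (2 * Mφ * Mφ') ^ 2 * α ^ 2 * (441 / 100) ^ d ≤ 1 / 2 := by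
    have hK0 : 0 ≤ 2 * Mφ * Mφ' := by positivity
    have e441 : (441 / 100 : ℝ) ^ d = ((21 / 10 : ℝ) ^ d) ^ 2 := by rw [← pow_mul, mul_comm, pow_mul]; norm_num
    rw [e441]
    rcases Nat.eq_zero_or_pos d with hd | hd
    · subst hd; simp
    · have hd1 : (1 : ℝ) ≤ d := by exact_mod_cast hd
      have hKc : 2 * Mφ * Mφ' ≤ c' + 1 := by rw [hcdef']; nlinarith
      have hcα' : c' * α ≤ (c' + 1) * α := mul_le_mul_of_nonneg_right (by linarith) hα0
      have h1 : c' * α * (21 / 10 : ℝ) ^ d ≤ 1 / 2 := by nlinarith [hcα', hαK, hY1]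
      have h2 : (2 * Mφ * Mφ') * α * (21 / 10 : ℝ) ^ d ≤ 1 / 2 := by
        have := mul_le_mul_of_nonneg_right (mul_le_mul_of_nonneg_right hKc hα0) (by positivity : (0 : ℝ) ≤ (21 / 10 : ℝ) ^ d)
        nlinarith [hαK]
      have h0b : 0 ≤ (2 * Mφ * Mφ') * α * (21 / 10 : ℝ) ^ d := by positivity
      calc (d : ℝ) * (2 * Mφ * Mφ') ^ 2 * α ^ 2 * ((21 / 10 : ℝ) ^ d) ^ 2
          = (c' * α * (21 / 10 : ℝ) ^ d) * ((2 * Mφ * Mφ') * α * (21 / 10 : ℝ) ^ d) := by rw [hcdef']; ring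
        _ ≤ (1 / 2) * (1 / 2) := mul_le_mul h1 h2 h0b (by norm_num)
        _ ≤ 1 / 2 := by norm_num
  exact qggq_coercive_tower_sharp_diagonal_geometric L m n φ c₀ η c₁ ha' hMφ hMφ' hφ hφ' U hUb hα0 hUε εU hεU hLε hLb hRS hpos' hηL hw
    hr0 hr1 hεg hwin hKα ψ

end Exists

end Literature.MathematicalPhysics.QuantumFieldTheory.Balaban1983to89.B9Eq365QGGQLowerVariationalWindowTowerSharpDiagonal

end
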